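import Summits.QuantumFields.YangMills.Theorems.BalabanUVNodesN12FlatLinAvgOntoPins
import Summits.QuantumFields.YangMills.Theorems.UnitScaleTiltProp8ChartHInvGeometry
import Literature.MathematicalPhysics.QuantumFieldTheory.Balaban1983to89.T4AxialGaugeSmallField

/-!
# DAG node N12 [B15] — (P4)′ road, step (T3ᵍ): THE BOX GAUGE AT A `j`-SITE — plaquette-smallness `< ε` on the `3^d`-block box around `B^j(y′)` puts the axial-gauge copy of `U₀` within
# `(d−1)(3L^j−1)·ε` of `1` on EVERY fine bond whose two end-points lie in the blocks `y′`, `y′ ± e_ν` (the sharp towers of all the rows at `y′`)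

Cell `pub-ymgap` (HUMAN RULINGS D-0062 ∕ D-0149), width seat `pub-ymgap-dag-n12-w6` g6 = the N12 (P4) clone by row (director-ym R463-ym; target = dag-n12-c g20's (P4)′ socket of record).
Key K1⁹ `stmt-QuantumFields-27364`, `--kind proof --supports … --as helper`; count-neutral; THEOREMS ONLY (0 `def`, 0 `sorry`).  Design note `HOME/pub-ymgap-dag-n12-w6/P4-DESIGN.md`.

CONSUMED BY NAME: pv26's `T4AxialGaugeSmallField` (`axialGauge`, `dist1_gaugeAct_axialGauge_le_of_mem_boxBonds`, `boxBonds`, `boxPlaqs`, `castSite`, `castSite_add_e`,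
`castSite_injOn_box` — the torus non-abelian Poincaré lemma on a non-wrapping box), n12-w5's `B15Prop1DatumSmall7AtZSequence.embIter_shift_apply`, torus cover `B15Eq112TorusCover`
(`cover`, `lift`, `cover_lift`), UST's `ChartHInv.val_embIter`, p11's `val_iterBlockOf`.

THE COORDINATES.  `z′ = ι_j y′` the fine centre; `h := (L^j − 1)∕2`; the box is `[lift z′ − (L^j + h), lift z′ + (L^j + h)]^d` on the cover `ℤ^d` (`3L^j` sites per direction,
non-wrapping as soon as `3L^j < sitesPerDir 0`).  A fine point `q` of the block `Y ∈ {y′, y′ ± e_ν}` is covered by `c_Y + (q − ι_j Y)` with `c_Y = lift z′ (± L^j e_ν)` and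
`|q − ι_j Y| ≤ h` coordinatewise, hence lies in the box; both ends of a bond covered in the box are consecutive cover points (injectivity on the enlarged box), so the bond is a
`boxBonds` member and the Poincaré lemma applies.

CONTENTS.  §1 coordinates (`abs_val_sub_val_embIter_iterBlockOf_le`, `castSite_eq_cover`, `exists_cover_near`).  §2 ★★★ `exists_boxGauge`.

HONEST FRAMING.  Torus∕cover coordinate bookkeeping by name; nothing of Bałaban's asserted; N12 NOT discharged; K1⁹ NOT closed; count-neutral (typed 28∕28 · discharged 5∕27 unmoved);
R4 closes only the conditional finite-𝕋⁴ rung `BalabanLadder.UV`; the YM mass gap (Clay) is NOT proved by any of this.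
-/

noncomputable section

open scoped BigOperators Matrix.Norms.L2Operator

namespace Summit.QuantumFields.YangMills.BalabanUVNodes.N12DirectSurjBoxGauge

open Literature.MathematicalPhysics.QuantumFieldTheory.Balaban1983to89
open B15DeterminingSets (embIter)
open B5Eq118OneStroke (iterBlockOf iterBlockOf_zero iterBlockOf_succ val_iterBlockOf)
open B15Eq112TorusCover (cover lift cover_lift cover_apply)
open B15Prop1DatumSmall7AtZSequence (embIter_shift_apply)
open T4AxialGaugeSmallField (castSite castSite_add_e castSite_injOn_box boxBonds boxPlaqs axialGauge dist1_gaugeAct_axialGauge_le_of_mem_boxBonds)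
open B7Prop1Explicit (e e_apply)
open B10StarCount (shift_unshift unshift_shift)
open Summit.QuantumFields.YangMills.Theorems.ChartHInv (val_embIter)

variable {P : Params}

/-! ## §1  Cover coordinates of the blocks near a `j`-site -/

section Coordinates

variable {j : ℕ}

/-- A fine point is within `(L^j − 1)∕2` of the centre of its `j`-block, coordinatewise (labels; standing range). [cite: Balaban1987RG1, (0.1) p.251] -/
theorem abs_val_sub_val_embIter_iterBlockOf_le (hj : j ≤ P.m + P.K) (q : Site P 0) (κ : Fin P.d) :
    |((q κ).val : ℤ) - (((embIter j (iterBlockOf j q)) κ).val : ℤ)| ≤ (((P.L ^ j - 1) / 2 : ℕ) : ℤ) := by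
  have h1 := val_iterBlockOf j hj q κ
  have h2 := val_embIter j hj (iterBlockOf j q) κ
  have h3 := T4UndoubledRP.two_mul_half_pow_add_one (P := P) j
  have hpos : 0 < P.L ^ j := pow_pos P.L_pos j
  have hlow : ((iterBlockOf j q) κ).val * P.L ^ j ≤ (q κ).val := by rw [h1]; exact Nat.div_mul_le_self _ _
  have hup : (q κ).val < ((iterBlockOf j q) κ).val * P.L ^ j + P.L ^ j := by rw [h1]; exact Nat.lt_div_mul_add hpos
  have hlow' : ((((iterBlockOf j q) κ).val * P.L ^ j : ℕ) : ℤ) ≤ ((q κ).val : ℤ) := by exact_mod_cast hlow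
  have hup' : ((q κ).val : ℤ) < ((((iterBlockOf j q) κ).val * P.L ^ j : ℕ) : ℤ) + ((P.L ^ j : ℕ) : ℤ) := by exact_mod_cast hup
  have h3' : 2 * ((((P.L ^ j - 1) / 2 : ℕ)) : ℤ) + 1 = ((P.L ^ j : ℕ) : ℤ) := by exact_mod_cast h3
  rw [h2, Nat.cast_add, abs_le]
  constructor <;> linarith

/-- The castSite of pv26 is the torus cover of p27 (same formula). [folklore] -/
theorem castSite_eq_cover (x : Fin P.d → ℤ) : (castSite x : Site P 0) = cover P x := rfl

/-- **COVER REPRESENTATIVES NEAR A CENTRE.**  For `q` in one of the blocks `y′`, `y′ + e_ν`, `y′ − e_ν` (`3L^j`… no wrap needed here) there is a cover point `x` with `castSite x = q` and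
`|x − lift (ι_j y′)| ≤ L^j + (L^j−1)∕2` coordinatewise. [cite: Balaban1987RG1, (0.1) p.251; Balaban1988Convergent, (2.13) pp.256–257] -/
theorem exists_cover_near (hj : j ≤ P.m + P.K) (y' : Site P j) (q : Site P 0)
    (hq : iterBlockOf j q = y' ∨ ∃ ν, iterBlockOf j q = y'.shift ν ∨ iterBlockOf j q = y'.unshift ν) :
    ∃ x : Fin P.d → ℤ, (castSite x : Site P 0) = q ∧
      ∀ κ, |x κ - lift P (embIter j y') κ| ≤ ((P.L ^ j : ℕ) : ℤ) + (((P.L ^ j - 1) / 2 : ℕ) : ℤ) := by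
  -- a cover point of the centre of the block of `q`, within `L^j` of `lift z′`
  obtain ⟨cY, hcY, hcYn⟩ : ∃ cY : Fin P.d → ℤ, cover P cY = embIter j (iterBlockOf j q) ∧ ∀ κ, |cY κ - lift P (embIter j y') κ| ≤ ((P.L ^ j : ℕ) : ℤ) := by
    rcases hq with h | ⟨ν, h | h⟩
    · refine ⟨lift P (embIter j y'), by rw [cover_lift, h], fun κ => by rw [sub_self, abs_zero]; positivity⟩
    · refine ⟨lift P (embIter j y') + Pi.single ν ((P.L ^ j : ℕ) : ℤ), ?_, fun κ => ?_⟩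
      · rw [h]; exact B15Prop1DatumSmall7AtZSequence.cover_add_single_pow j (cover_lift _) ν
      · simp only [Pi.add_apply, add_sub_cancel_left]
        by_cases hκ : κ = ν
        · subst hκ; rw [Pi.single_eq_same, abs_of_nonneg (by positivity)]
        · rw [Pi.single_eq_of_ne hκ, abs_zero]; positivity
    · refine ⟨lift P (embIter j y') - Pi.single ν ((P.L ^ j : ℕ) : ℤ), ?_, fun κ => ?_⟩
      · funext κ
        rw [h, cover_apply, Pi.sub_apply, Int.cast_sub]
        have hz : ((lift P (embIter j y') κ : ℤ) : ZMod (P.sitesPerDir 0)) = embIter j y' κ := by rw [← cover_apply, cover_lift]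
        rw [hz, show y' = (y'.unshift ν).shift ν from (shift_unshift y' ν).symm, embIter_shift_apply, unshift_shift]
        by_cases hκ : κ = ν
        · subst hκ; rw [Pi.single_eq_same, if_pos rfl, Int.cast_natCast, add_sub_cancel_right]
        · rw [Pi.single_eq_of_ne hκ, if_neg hκ, add_zero, Int.cast_zero, sub_zero]
      · simp only [Pi.sub_apply, sub_sub_cancel_left, abs_neg]
        by_cases hκ : κ = ν
        · subst hκ; rw [Pi.single_eq_same, abs_of_nonneg (by positivity)]
        · rw [Pi.single_eq_of_ne hκ, abs_zero]; positivity
  refine ⟨fun κ => cY κ + (((q κ).val : ℤ) - (((embIter j (iterBlockOf j q)) κ).val : ℤ)), ?_, fun κ => ?_⟩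
  · funext κ
    have hc : ((cY κ : ℤ) : ZMod (P.sitesPerDir 0)) = embIter j (iterBlockOf j q) κ := by rw [← cover_apply, hcY]
    show ((cY κ + (((q κ).val : ℤ) - (((embIter j (iterBlockOf j q)) κ).val : ℤ)) : ℤ) : ZMod (P.sitesPerDir 0)) = q κ
    rw [Int.cast_add, Int.cast_sub, Int.cast_natCast, Int.cast_natCast, hc, ZMod.natCast_zmod_val, ZMod.natCast_zmod_val, add_sub_cancel]
  · have h1 := hcYn κ
    have h2 := abs_val_sub_val_embIter_iterBlockOf_le hj q κ
    calc |cY κ + (((q κ).val : ℤ) - (((embIter j (iterBlockOf j q)) κ).val : ℤ)) - lift P (embIter j y') κ|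
        = |(cY κ - lift P (embIter j y') κ) + (((q κ).val : ℤ) - (((embIter j (iterBlockOf j q)) κ).val : ℤ))| := by ring_nf
      _ ≤ |cY κ - lift P (embIter j y') κ| + |((q κ).val : ℤ) - (((embIter j (iterBlockOf j q)) κ).val : ℤ)| := abs_add_le _ _
      _ ≤ _ := add_le_add h1 h2

end Coordinates

/-! ## §2  The box gauge -/

section Gauge

variable {N : ℕ} [NeZero N] {j : ℕ}

/-- ★★★ **THE BOX GAUGE AT A `j`-SITE.**  Let `z′ = ι_j y′`, `h = (L^j−1)∕2`, and suppose `3L^j < sitesPerDir 0` (the `3^d`-block box does not wrap).  If every plaquette of the cover box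
`[lift z′ − (L^j + h), lift z′ + (L^j + h)]^d` has `dist1 (U(∂p)) < ε` (`0 ≤ ε`), then the axial gauge `u` of that box satisfies `‖↑(U^u b) − 1‖ ≤ (d−1)(3L^j−1)·ε` on EVERY fine bond `b`
whose two end-points lie in blocks among `y′`, `y′ + e_ν`, `y′ − e_ν` — in particular on the sharp towers of all the rows at `y′`. [cite: Balaban1987RG1, (0.1) p.251; Balaban1988Convergent, (2.13) pp.256–257] -/
theorem exists_boxGauge (hj : j ≤ P.m + P.K) (hwrap : 3 * P.L ^ j < P.sitesPerDir 0) (y' : Site P j) (U : GaugeField P 0 (Matrix.specialUnitaryGroup (Fin N) ℂ)) {ε : ℝ} (hε : 0 ≤ ε)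
    (hP : PlaqSmallOn (boxPlaqs (P := P) (j := 0)
        (fun κ => lift P (embIter j y') κ - (((P.L ^ j : ℕ) : ℤ) + (((P.L ^ j - 1) / 2 : ℕ) : ℤ)))
        (fun κ => lift P (embIter j y') κ + (((P.L ^ j : ℕ) : ℤ) + (((P.L ^ j - 1) / 2 : ℕ) : ℤ)))) ε U) :
    ∃ u : GaugeTransf P 0 (Matrix.specialUnitaryGroup (Fin N) ℂ), ∀ b₀ : PBond P 0,
      (iterBlockOf j b₀.src = y' ∨ ∃ ν, iterBlockOf j b₀.src = y'.shift ν ∨ iterBlockOf j b₀.src = y'.unshift ν) →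
      (iterBlockOf j b₀.tgt = y' ∨ ∃ ν, iterBlockOf j b₀.tgt = y'.shift ν ∨ iterBlockOf j b₀.tgt = y'.unshift ν) →
      ‖((GaugeField.gaugeAct u U b₀ : Matrix.specialUnitaryGroup (Fin N) ℂ) : Matrix (Fin N) (Fin N) ℂ) - 1‖
        ≤ ((P.d - 1 : ℕ) : ℝ) * ((2 * (P.L ^ j + (P.L ^ j - 1) / 2) : ℕ) : ℝ) * ε := by
  set R : ℤ := ((P.L ^ j : ℕ) : ℤ) + (((P.L ^ j - 1) / 2 : ℕ) : ℤ) with hR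
  set lo : Fin P.d → ℤ := fun κ => lift P (embIter j y') κ - R with hlo
  set hi : Fin P.d → ℤ := fun κ => lift P (embIter j y') κ + R with hhi
  have hR0 : 0 ≤ R := by rw [hR]; positivity
  have h3 := T4UndoubledRP.two_mul_half_pow_add_one (P := P) j
  have h3' : 2 * ((((P.L ^ j - 1) / 2 : ℕ)) : ℤ) + 1 = ((P.L ^ j : ℕ) : ℤ) := by exact_mod_cast h3
  have hw : 3 * ((P.L ^ j : ℕ) : ℤ) < ((P.sitesPerDir 0 : ℕ) : ℤ) := by exact_mod_cast hwrap
  have hcast2 : (((2 * (P.L ^ j + (P.L ^ j - 1) / 2) : ℕ) : ℤ)) = 2 * (((P.L ^ j : ℕ) : ℤ) + (((P.L ^ j - 1) / 2 : ℕ) : ℤ)) := by push_cast; ring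
  have hn : ∀ κ, hi κ ≤ lo κ + ((2 * (P.L ^ j + (P.L ^ j - 1) / 2) : ℕ) : ℤ) := fun κ => by
    rw [hcast2]; simp only [hlo, hhi, hR]; linarith
  have hnN : (2 * (P.L ^ j + (P.L ^ j - 1) / 2) : ℕ) < P.sitesPerDir 0 := by
    have h32 : 2 * (P.L ^ j + (P.L ^ j - 1) / 2) + 1 = 3 * P.L ^ j := by omega
    omega
  -- injectivity box `[lo, hi + 1]`
  have hN1 : ∀ κ, (hi κ + 1) - lo κ < P.sitesPerDir 0 := fun κ => by
    simp only [hlo, hhi, hR]; linarith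
  refine ⟨axialGauge U lo hi, fun b₀ hs ht => ?_⟩
  -- cover points of the two ends
  obtain ⟨x, hx, hxn⟩ := exists_cover_near hj y' b₀.src hs
  obtain ⟨x', hx', hx'n⟩ := exists_cover_near hj y' b₀.tgt ht
  have hxlo : lo ≤ x := fun κ => by have := hxn κ; rw [abs_le] at this; simp only [hlo]; linarith [this.1]
  have hxhi : x ≤ hi := fun κ => by have := hxn κ; rw [abs_le] at this; simp only [hhi]; linarith [this.2]
  have hx'lo : lo ≤ x' := fun κ => by have := hx'n κ; rw [abs_le] at this; simp only [hlo]; linarith [this.1]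
  have hx'hi : x' ≤ hi := fun κ => by have := hx'n κ; rw [abs_le] at this; simp only [hhi]; linarith [this.2]
  -- the two cover points are consecutive
  have heq : x + e b₀.dir = x' := by
    refine castSite_injOn_box (j := 0) (lo := lo) (hi := fun κ => hi κ + 1) hN1 ?_ ?_ hx'lo (fun κ => (hx'hi κ).trans (by linarith)) ?_
    · exact fun κ => (hxlo κ).trans (by rw [Pi.add_apply, e_apply]; split_ifs <;> linarith)
    · exact fun κ => by rw [Pi.add_apply, e_apply]; split_ifs <;> linarith [hxhi κ]
    · rw [castSite_add_e, hx, hx']; rfl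
  have hb : b₀ ∈ boxBonds (P := P) (j := 0) lo hi := ⟨x, hxlo, by rw [heq]; exact hx'hi, by rw [hx]⟩
  have hd := dist1_gaugeAct_axialGauge_le_of_mem_boxBonds U (subset_refl _) hP hε hn hnN hb
  exact hd

end Gauge

end Summit.QuantumFields.YangMills.BalabanUVNodes.N12DirectSurjBoxGauge

end
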